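import Mathlib
import HarnessLib
import Literature.Probability.Percolation.MinOpenCut
import Literature.Probability.Percolation.MinOpenCutMenger
import Summits.CriticalPhenomena.PercolationContinuityZ3.Theses.PercBudgetLadder
import Summits.CriticalPhenomena.PercolationContinuityZ3.Theorems.PercBudgetLadderBudgetTightnessStubMarkov
import Summits.CriticalPhenomena.PercolationContinuityZ3.Theorems.PercBudgetLadderBudgetTightnessStubSixLids
import Summits.CriticalPhenomena.PercolationContinuityZ3.Theorems.PercBudgetLadderBudgetTightnessStubBkTail
import Summits.CriticalPhenomena.PercolationContinuityZ3.Theorems.PercBudgetLadderBudgetTightnessStubPatchCutset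
import Summits.CriticalPhenomena.PercolationContinuityZ3.Theorems.PercBudgetLadderBudgetTightnessCoreDensity

/-!
# The dictionary of line `Sketch` (crux `BudgetTightness`, stmt-CriticalPhenomena-5248):
# `BudgetTightness ⟺ MeanCutBoundedIO(p_c) ⟺ SlabCutQuadraticIO(p_c)`, and the necessary DENSITY half

Helper file (`--supports stmt-CriticalPhenomena-5248`) assembling the LANDED stubs of line `Sketch`
(`Theorems/PercBudgetLadderBudgetTightnessStub{Markov,SixLids,BkTail,PatchCutset}.lean`,
`…CoreDensity.lean`) into the exact re-coordinatisation of the crux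
`Summit.CriticalPhenomena.PercolationContinuityZ3.Theses.PercBudgetLadder.BudgetTightness` (route
`PercBudgetLadder`, rung r2: bounded-budget tightness of critical annuli of `ℤ³` along a subsequence).
Everything here is kernel-checked and unconditional; nothing closes the item (the crux is OPEN and, by
this file, EQUIVALENT to each of the two first-moment statements below).

Notation of the docstrings (all statements are written out def-free): `P = P_{p_c(ℤ³)}`,
`MinCut(n, l n)(ω) = minOpenCutIn ↑(box 3 (l n)) ↑(box 3 n) ↑(innerBoundary (zdGraph 3) (box 3 (l n))) ω`
(the route's budget: `{MinCut ≤ k}` is verbatim the route's event by `minOpenCutIn_le_iff`),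
`Q(L,h) = Set.Icc ![0,0,0] ![L,L,h] = [0,L]²×[0,h]` with bottom layer `Set.Icc ![0,0,0] ![L,L,0]` and top
layer `Set.Icc ![0,0,h] ![L,L,h]`, `S(L,h)(ω) = minOpenCutIn Q(L,h) bottom top ω` (bottom-to-top min-cut =
maximal number of edge-disjoint open vertical crossings, `maxDisjointOpenPathsIn_eq_minOpenCutIn`),
`E[X] = ∫ (X ω).toNat ∂P`, `N(L,h)(ω)` = number of open clusters of `Q(L,h)` meeting bottom and top.

* `MeanCutBoundedIO(p_c)`: `∃ l C, 2 ≤ l ∧ ∀ N, ∃ n ≥ N, E[MinCut(n, l n)] ≤ C`;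
* `SlabCutQuadraticIO(p_c)`: `∃ C, ∀ H, ∃ h ≥ H, ∀ L ≥ h, h²·E[S(L,h)] ≤ C·L²`
  ("Kesten's critical slab flow constant sits at its floor i.o.": `liminf_h h² τ_h(p_c) < ∞`).

Results:
* `budgetTightness_iff_meanCutBoundedIO` — (⇐) Markov (`stub_markov`); (⇒) BK tail + Menger (`stub_bkTail`).
* `budgetTightness_iff_slabCutQuadraticIO` — (⇐) six-lid routing (`stub_sixLids`) + Markov;
  (⇒) BK tail + mid-plane patch cutsets (`stub_patchCutset`).
* `numCrossingQuadraticIO_of_budgetTightness` — the crux implies the DENSITY statement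
  `∃ C, ∀ H, ∃ h ≥ H, ∀ L ≥ h, h²·E[N(L,h)] ≤ C·L²` (tight spanning-cluster number in slab form, the `d < 6`
  hyperscaling statement; `stub_numCrossingLe`): a NECESSARY condition, false in `d ≥ 7` under `η = 0`.
The floor `c·L² ≤ h²·E[S(L,h)]` (`stub_floor`, `stub_critCrossing`), the ceiling by level cutsets
(`stub_ceiling`) and the lateral limit `τ_h(p)` (`stub_tauLimit`) are landed in their own files; the
sandwich corollaries join this file by the append protocol once the farm has built those modules.
-/

noncomputable section

namespace Summit.CriticalPhenomena.PercolationContinuityZ3.Theorems.BudgetTightness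

open MeasureTheory Filter Topology
open Literature.Probability.Percolation Literature.Probability.LatticeModels
open Summit.CriticalPhenomena.PercolationContinuityZ3.Theses.PercBudgetLadder (BudgetTightness)

namespace Dictionary

/-- Arithmetic of the six-lids exchange rate: from `h² I ≤ C (4h+4)²` and `h ≥ 1`, `I ≤ 64 · max C 0`. -/
theorem integral_le_of_sq_mul_le {h : ℕ} (hh : 1 ≤ h) {I C : ℝ}
    (hle : (h : ℝ) ^ 2 * I ≤ C * (((4 * h + 4 : ℕ) : ℝ)) ^ 2) : I ≤ 64 * max C 0 := by
  have hh1 : (1 : ℝ) ≤ h := by exact_mod_cast hh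
  have hpos : (0 : ℝ) < (h : ℝ) ^ 2 := by positivity
  have h84 : (((4 * h + 4 : ℕ) : ℝ)) ≤ 8 * h := by push_cast; linarith
  have hsq : (((4 * h + 4 : ℕ) : ℝ)) ^ 2 ≤ 64 * (h : ℝ) ^ 2 := by nlinarith
  have hC : C * (((4 * h + 4 : ℕ) : ℝ)) ^ 2 ≤ max C 0 * (64 * (h : ℝ) ^ 2) :=
    calc C * (((4 * h + 4 : ℕ) : ℝ)) ^ 2 ≤ max C 0 * (((4 * h + 4 : ℕ) : ℝ)) ^ 2 :=
          mul_le_mul_of_nonneg_right (le_max_left _ _) (by positivity)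
      _ ≤ max C 0 * (64 * (h : ℝ) ^ 2) := mul_le_mul_of_nonneg_left hsq (le_max_right _ _)
  have : (h : ℝ) ^ 2 * I ≤ (h : ℝ) ^ 2 * (64 * max C 0) := by nlinarith
  exact le_of_mul_le_mul_left this hpos

/-- **Composition lemma (sorry-free; hypotheses = the statements of `stub_markov`, `stub_sixLids`,
`stub_core` verbatim).** Core ⇒ `E_{p_c}[S(4h+4, h)] ≤ 64 C⁺` along the good `h ≥ 1` ⇒ (six lids)
`E_{p_c}[MinCut(h+1, 2(h+1))] ≤ 384 C⁺` ⇒ `MeanCutBoundedIO(p_c)` with `l = 2` ⇒ (Markov) the crux. -/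
theorem budgetTightness_of_core_of_stubs
    (hM : (∃ (l : ℕ) (C : ℝ), 2 ≤ l ∧ ∀ N : ℕ, ∃ n : ℕ, N ≤ n ∧
      ∫ ω, ((minOpenCutIn (↑(box 3 (l * n)) : Set (Site 3)) (↑(box 3 n) : Set (Site 3))
        (↑(innerBoundary (zdGraph 3) (box 3 (l * n))) : Set (Site 3)) ω).toNat : ℝ)
        ∂(bondPercolation (zdGraph 3) (criticalProbI 3)) ≤ C) →
      ∃ (k l : ℕ) (c : ℝ), 2 ≤ l ∧ 0 < c ∧ ∀ N : ℕ, ∃ n : ℕ, N ≤ n ∧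
        c ≤ (bondPercolation (zdGraph 3) (criticalProbI 3)).real
          {ω | ∃ S : Finset (Sym2 (Site 3)), S.card ≤ k ∧
            ¬ ∃ x ∈ box 3 n, ∃ y ∈ innerBoundary (zdGraph 3) (box 3 (l * n)),
              (ω \ ↑S) ∈ openConnIn (↑(box 3 (l * n)) : Set (Site 3)) x y})
    (hS : ∀ (p : unitInterval) (h : ℕ), 1 ≤ h →
      ∫ ω, ((minOpenCutIn (↑(box 3 (2 * (h + 1))) : Set (Site 3)) (↑(box 3 (h + 1)) : Set (Site 3))
          (↑(innerBoundary (zdGraph 3) (box 3 (2 * (h + 1)))) : Set (Site 3)) ω).toNat : ℝ)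
          ∂(bondPercolation (zdGraph 3) p) ≤
      6 * ∫ ω, ((minOpenCutIn
          (Set.Icc (![0, 0, 0] : Site 3) ![((4 * h + 4 : ℕ) : ℤ), ((4 * h + 4 : ℕ) : ℤ), (h : ℤ)])
          (Set.Icc (![0, 0, 0] : Site 3) ![((4 * h + 4 : ℕ) : ℤ), ((4 * h + 4 : ℕ) : ℤ), 0])
          (Set.Icc (![0, 0, (h : ℤ)] : Site 3) ![((4 * h + 4 : ℕ) : ℤ), ((4 * h + 4 : ℕ) : ℤ), (h : ℤ)])
          ω).toNat : ℝ) ∂(bondPercolation (zdGraph 3) p))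
    (hC : ∃ C : ℝ, ∀ H : ℕ, ∃ h : ℕ, H ≤ h ∧ ∀ L : ℕ, h ≤ L →
      (h : ℝ) ^ 2 * ∫ ω, ((minOpenCutIn
          (Set.Icc (![0, 0, 0] : Site 3) ![(L : ℤ), (L : ℤ), (h : ℤ)])
          (Set.Icc (![0, 0, 0] : Site 3) ![(L : ℤ), (L : ℤ), 0])
          (Set.Icc (![0, 0, (h : ℤ)] : Site 3) ![(L : ℤ), (L : ℤ), (h : ℤ)])
          ω).toNat : ℝ) ∂(bondPercolation (zdGraph 3) (criticalProbI 3)) ≤ C * (L : ℝ) ^ 2) :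
    ∃ (k l : ℕ) (c : ℝ), 2 ≤ l ∧ 0 < c ∧ ∀ N : ℕ, ∃ n : ℕ, N ≤ n ∧
        c ≤ (bondPercolation (zdGraph 3) (criticalProbI 3)).real
          {ω | ∃ S : Finset (Sym2 (Site 3)), S.card ≤ k ∧
            ¬ ∃ x ∈ box 3 n, ∃ y ∈ innerBoundary (zdGraph 3) (box 3 (l * n)),
              (ω \ ↑S) ∈ openConnIn (↑(box 3 (l * n)) : Set (Site 3)) x y} := by
  obtain ⟨C, hcore⟩ := hC
  refine hM ⟨2, 384 * max C 0, le_rfl, fun N => ?_⟩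
  obtain ⟨h, hHh, hL⟩ := hcore (max N 1)
  have hh1 : 1 ≤ h := le_trans (le_max_right _ _) hHh
  have hslab := hL (4 * h + 4) (by omega)
  have hI : ∫ ω, ((minOpenCutIn
          (Set.Icc (![0, 0, 0] : Site 3) ![((4 * h + 4 : ℕ) : ℤ), ((4 * h + 4 : ℕ) : ℤ), (h : ℤ)])
          (Set.Icc (![0, 0, 0] : Site 3) ![((4 * h + 4 : ℕ) : ℤ), ((4 * h + 4 : ℕ) : ℤ), 0])
          (Set.Icc (![0, 0, (h : ℤ)] : Site 3) ![((4 * h + 4 : ℕ) : ℤ), ((4 * h + 4 : ℕ) : ℤ), (h : ℤ)])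
          ω).toNat : ℝ) ∂(bondPercolation (zdGraph 3) (criticalProbI 3)) ≤ 64 * max C 0 :=
    integral_le_of_sq_mul_le hh1 hslab
  refine ⟨h + 1, by omega, ?_⟩
  have hsix := hS (criticalProbI 3) h hh1
  calc ∫ ω, ((minOpenCutIn (↑(box 3 (2 * (h + 1))) : Set (Site 3)) (↑(box 3 (h + 1)) : Set (Site 3))
          (↑(innerBoundary (zdGraph 3) (box 3 (2 * (h + 1)))) : Set (Site 3)) ω).toNat : ℝ)
          ∂(bondPercolation (zdGraph 3) (criticalProbI 3))
      ≤ 6 * (64 * max C 0) := hsix.trans (by gcongr)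
    _ = 384 * max C 0 := by ring

/-- Arithmetic of the patch exchange rate: for `n ≥ 1`, `l ≥ 2`, `L ≥ 2ln`,
`(2ln)² · ⌈(L+1)/(2n+1)⌉² ≤ 4 l² L²`. -/
theorem patch_rate_le {n l L : ℕ} (hn : 1 ≤ n) (hl : 2 ≤ l) (hL : 2 * l * n ≤ L) :
    (((2 * l * n : ℕ) : ℝ)) ^ 2 * ((((L + 2 * n + 1) / (2 * n + 1) : ℕ) : ℝ)) ^ 2 ≤
      4 * (l : ℝ) ^ 2 * (L : ℝ) ^ 2 := by
  have hn1 : (1 : ℝ) ≤ n := by exact_mod_cast hn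
  have hl2 : (2 : ℝ) ≤ l := by exact_mod_cast hl
  have hLr : 2 * (l : ℝ) * n ≤ L := by exact_mod_cast hL
  have hd : (0 : ℝ) < 2 * n + 1 := by positivity
  -- `⌈(L+1)/(2n+1)⌉ ≤ (L + 2n + 1)/(2n+1) ≤ 2L/(2n+1) ≤ L/n`
  have hA : ((((L + 2 * n + 1) / (2 * n + 1) : ℕ) : ℝ)) ≤ (L : ℝ) / n := by
    have h1 : ((((L + 2 * n + 1) / (2 * n + 1) : ℕ) : ℝ)) ≤ ((L + 2 * n + 1 : ℕ) : ℝ) / ((2 * n + 1 : ℕ) : ℝ) :=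
      Nat.cast_div_le
    have hL4 : 4 * (n : ℝ) ≤ L := by nlinarith
    have h2 : ((L + 2 * n + 1 : ℕ) : ℝ) / ((2 * n + 1 : ℕ) : ℝ) ≤ (L : ℝ) / n := by
      rw [div_le_div_iff₀ (by positivity) (by positivity)]
      push_cast
      nlinarith [mul_le_mul_of_nonneg_right hL4 (by positivity : (0 : ℝ) ≤ n)]
    exact h1.trans h2
  have hA0 : (0 : ℝ) ≤ ((((L + 2 * n + 1) / (2 * n + 1) : ℕ) : ℝ)) := by positivity
  have hsq : ((((L + 2 * n + 1) / (2 * n + 1) : ℕ) : ℝ)) ^ 2 ≤ ((L : ℝ) / n) ^ 2 := by gcongr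
  calc (((2 * l * n : ℕ) : ℝ)) ^ 2 * ((((L + 2 * n + 1) / (2 * n + 1) : ℕ) : ℝ)) ^ 2
      ≤ (((2 * l * n : ℕ) : ℝ)) ^ 2 * ((L : ℝ) / n) ^ 2 := by gcongr
    _ = 4 * (l : ℝ) ^ 2 * (L : ℝ) ^ 2 := by
        push_cast
        field_simp
        ring

/-- **Dictionary lemma (sorry-free; hypotheses = the statements of `stub_bkTail` and
`stub_patchCutset` verbatim): the crux implies `SlabCutQuadraticIO(p_c)` (the statement of
`stub_core`).** From `BudgetTightness` get `(k, l, c)`; along the good `n ≥ 1` the budget event is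
`{MinCut(n, l n) ≤ k}` (`minOpenCutIn_le_iff`), so `E[MinCut(n, l n)] ≤ (k+1)/c` (BK tail) and, with
`h = 2 l n`, `h² E[S(L, h)] ≤ (2ln)² ⌈(L+1)/(2n+1)⌉² (k+1)/c ≤ 4 l² (k+1)/c · L²` for every `L ≥ h`
(patch cutsets). Together with `line_composition`: `stub_core ⟺ BudgetTightness` modulo the four
dictionary stubs. -/
theorem core_of_budgetTightness_of_stubs
    (hB : ∀ (p : unitInterval) (n l k : ℕ) (c : ℝ), 1 ≤ n → 2 ≤ l → 0 < c →
      c ≤ (bondPercolation (zdGraph 3) p).real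
        {ω | minOpenCutIn (↑(box 3 (l * n)) : Set (Site 3)) (↑(box 3 n) : Set (Site 3))
          (↑(innerBoundary (zdGraph 3) (box 3 (l * n))) : Set (Site 3)) ω ≤ k} →
      ∫ ω, ((minOpenCutIn (↑(box 3 (l * n)) : Set (Site 3)) (↑(box 3 n) : Set (Site 3))
          (↑(innerBoundary (zdGraph 3) (box 3 (l * n))) : Set (Site 3)) ω).toNat : ℝ)
          ∂(bondPercolation (zdGraph 3) p) ≤ ((k : ℝ) + 1) / c)
    (hP : ∀ (p : unitInterval) (m l L : ℕ), 1 ≤ m → 2 ≤ l →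
      ∫ ω, ((minOpenCutIn
          (Set.Icc (![0, 0, 0] : Site 3) ![(L : ℤ), (L : ℤ), ((2 * l * m : ℕ) : ℤ)])
          (Set.Icc (![0, 0, 0] : Site 3) ![(L : ℤ), (L : ℤ), 0])
          (Set.Icc (![0, 0, ((2 * l * m : ℕ) : ℤ)] : Site 3) ![(L : ℤ), (L : ℤ), ((2 * l * m : ℕ) : ℤ)])
          ω).toNat : ℝ) ∂(bondPercolation (zdGraph 3) p) ≤
      ((((L + 2 * m + 1) / (2 * m + 1) : ℕ) : ℝ)) ^ 2 *
        ∫ ω, ((minOpenCutIn (↑(box 3 (l * m)) : Set (Site 3)) (↑(box 3 m) : Set (Site 3))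
          (↑(innerBoundary (zdGraph 3) (box 3 (l * m))) : Set (Site 3)) ω).toNat : ℝ)
          ∂(bondPercolation (zdGraph 3) p))
    (hBT : Summit.CriticalPhenomena.PercolationContinuityZ3.Theses.PercBudgetLadder.BudgetTightness) :
    ∃ C : ℝ, ∀ H : ℕ, ∃ h : ℕ, H ≤ h ∧ ∀ L : ℕ, h ≤ L →
      (h : ℝ) ^ 2 * ∫ ω, ((minOpenCutIn
          (Set.Icc (![0, 0, 0] : Site 3) ![(L : ℤ), (L : ℤ), (h : ℤ)])
          (Set.Icc (![0, 0, 0] : Site 3) ![(L : ℤ), (L : ℤ), 0])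
          (Set.Icc (![0, 0, (h : ℤ)] : Site 3) ![(L : ℤ), (L : ℤ), (h : ℤ)])
          ω).toNat : ℝ) ∂(bondPercolation (zdGraph 3) (criticalProbI 3)) ≤ C * (L : ℝ) ^ 2 := by
  obtain ⟨k, l, c, hl, hc, hio⟩ := hBT
  refine ⟨4 * (l : ℝ) ^ 2 * (((k : ℝ) + 1) / c), fun H => ?_⟩
  obtain ⟨n, hn, hbound⟩ := hio (max H 1)
  have hn1 : 1 ≤ n := le_trans (le_max_right _ _) hn
  -- the route's event is `{MinCut(n, l n) ≤ k}`
  have hev : {ω : BondConfig (Site 3) | ∃ S : Finset (Sym2 (Site 3)), S.card ≤ k ∧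
      ¬ ∃ x ∈ box 3 n, ∃ y ∈ innerBoundary (zdGraph 3) (box 3 (l * n)),
        (ω \ ↑S) ∈ openConnIn (↑(box 3 (l * n)) : Set (Site 3)) x y} =
      {ω | minOpenCutIn (↑(box 3 (l * n)) : Set (Site 3)) (↑(box 3 n) : Set (Site 3))
          (↑(innerBoundary (zdGraph 3) (box 3 (l * n))) : Set (Site 3)) ω ≤ k} := by
    ext ω
    simp only [Set.mem_setOf_eq, minOpenCutIn_le_iff, Finset.mem_coe]
  rw [hev] at hbound
  have hmean := hB (criticalProbI 3) n l k c hn1 hl hc hbound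
  have hHn : H ≤ 2 * l * n :=
    (le_trans (le_max_left _ _) hn).trans (Nat.le_mul_of_pos_left n (by omega))
  refine ⟨2 * l * n, hHn, fun L hL => ?_⟩
  have hpatch := hP (criticalProbI 3) n l L hn1 hl
  have hI0 : 0 ≤ ∫ ω, ((minOpenCutIn (↑(box 3 (l * n)) : Set (Site 3)) (↑(box 3 n) : Set (Site 3))
          (↑(innerBoundary (zdGraph 3) (box 3 (l * n))) : Set (Site 3)) ω).toNat : ℝ)
          ∂(bondPercolation (zdGraph 3) (criticalProbI 3)) :=
    integral_nonneg fun ω => by positivity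
  have hrate := patch_rate_le hn1 hl hL
  calc (((2 * l * n : ℕ) : ℝ)) ^ 2 * ∫ ω, ((minOpenCutIn
          (Set.Icc (![0, 0, 0] : Site 3) ![(L : ℤ), (L : ℤ), ((2 * l * n : ℕ) : ℤ)])
          (Set.Icc (![0, 0, 0] : Site 3) ![(L : ℤ), (L : ℤ), 0])
          (Set.Icc (![0, 0, ((2 * l * n : ℕ) : ℤ)] : Site 3) ![(L : ℤ), (L : ℤ), ((2 * l * n : ℕ) : ℤ)])
          ω).toNat : ℝ) ∂(bondPercolation (zdGraph 3) (criticalProbI 3))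
      ≤ (((2 * l * n : ℕ) : ℝ)) ^ 2 * (((((L + 2 * n + 1) / (2 * n + 1) : ℕ) : ℝ)) ^ 2 *
          ∫ ω, ((minOpenCutIn (↑(box 3 (l * n)) : Set (Site 3)) (↑(box 3 n) : Set (Site 3))
            (↑(innerBoundary (zdGraph 3) (box 3 (l * n))) : Set (Site 3)) ω).toNat : ℝ)
            ∂(bondPercolation (zdGraph 3) (criticalProbI 3))) := by gcongr
    _ ≤ (((2 * l * n : ℕ) : ℝ)) ^ 2 * ((((L + 2 * n + 1) / (2 * n + 1) : ℕ) : ℝ)) ^ 2 *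
          (((k : ℝ) + 1) / c) := by rw [← mul_assoc]; gcongr
    _ ≤ 4 * (l : ℝ) ^ 2 * (L : ℝ) ^ 2 * (((k : ℝ) + 1) / c) :=
        mul_le_mul_of_nonneg_right hrate (div_nonneg (by positivity) hc.le)
    _ = 4 * (l : ℝ) ^ 2 * (((k : ℝ) + 1) / c) * (L : ℝ) ^ 2 := by ring

end Dictionary

open Dictionary

/-- **`SlabCutQuadraticIO(p_c) → BudgetTightness`** (six lids + Markov; the composition of line `Sketch`). -/
theorem budgetTightness_of_slabCutQuadraticIO
    (hC : ∃ C : ℝ, ∀ H : ℕ, ∃ h : ℕ, H ≤ h ∧ ∀ L : ℕ, h ≤ L →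
      (h : ℝ) ^ 2 * ∫ ω, ((minOpenCutIn
          (Set.Icc (![0, 0, 0] : Site 3) ![(L : ℤ), (L : ℤ), (h : ℤ)])
          (Set.Icc (![0, 0, 0] : Site 3) ![(L : ℤ), (L : ℤ), 0])
          (Set.Icc (![0, 0, (h : ℤ)] : Site 3) ![(L : ℤ), (L : ℤ), (h : ℤ)])
          ω).toNat : ℝ) ∂(bondPercolation (zdGraph 3) (criticalProbI 3)) ≤ C * (L : ℝ) ^ 2) :
    BudgetTightness :=
  budgetTightness_of_core_of_stubs stub_markov stub_sixLids hC

/-- **`BudgetTightness → SlabCutQuadraticIO(p_c)`** (BK tail + patch cutsets; the converse). -/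
theorem slabCutQuadraticIO_of_budgetTightness (hBT : BudgetTightness) :
    ∃ C : ℝ, ∀ H : ℕ, ∃ h : ℕ, H ≤ h ∧ ∀ L : ℕ, h ≤ L →
      (h : ℝ) ^ 2 * ∫ ω, ((minOpenCutIn
          (Set.Icc (![0, 0, 0] : Site 3) ![(L : ℤ), (L : ℤ), (h : ℤ)])
          (Set.Icc (![0, 0, 0] : Site 3) ![(L : ℤ), (L : ℤ), 0])
          (Set.Icc (![0, 0, (h : ℤ)] : Site 3) ![(L : ℤ), (L : ℤ), (h : ℤ)])
          ω).toNat : ℝ) ∂(bondPercolation (zdGraph 3) (criticalProbI 3)) ≤ C * (L : ℝ) ^ 2 :=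
  core_of_budgetTightness_of_stubs stub_bkTail stub_patchCutset hBT

/-- **THE DICTIONARY, slab form: `BudgetTightness ⟺ SlabCutQuadraticIO(p_c)`** — the crux of route
`PercBudgetLadder` (tight critical annulus min-cut i.o.) is EQUIVALENT to "the critical slab flow constant
sits at its universal floor infinitely often": `∃ C, ∀ H, ∃ h ≥ H, ∀ L ≥ h, h²·E_{p_c}[S(L,h)] ≤ C·L²`. -/
theorem budgetTightness_iff_slabCutQuadraticIO :
    BudgetTightness ↔
      ∃ C : ℝ, ∀ H : ℕ, ∃ h : ℕ, H ≤ h ∧ ∀ L : ℕ, h ≤ L →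
        (h : ℝ) ^ 2 * ∫ ω, ((minOpenCutIn
            (Set.Icc (![0, 0, 0] : Site 3) ![(L : ℤ), (L : ℤ), (h : ℤ)])
            (Set.Icc (![0, 0, 0] : Site 3) ![(L : ℤ), (L : ℤ), 0])
            (Set.Icc (![0, 0, (h : ℤ)] : Site 3) ![(L : ℤ), (L : ℤ), (h : ℤ)])
            ω).toNat : ℝ) ∂(bondPercolation (zdGraph 3) (criticalProbI 3)) ≤ C * (L : ℝ) ^ 2 :=
  ⟨slabCutQuadraticIO_of_budgetTightness, budgetTightness_of_slabCutQuadraticIO⟩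

/-- **`stub_dictionary` (registered stub of line `Sketch`): the slab dictionary under its registered
name** — `BudgetTightness ⟺ SlabCutQuadraticIO(p_c)`. -/
theorem stub_dictionary :
    Summit.CriticalPhenomena.PercolationContinuityZ3.Theses.PercBudgetLadder.BudgetTightness ↔
      ∃ C : ℝ, ∀ H : ℕ, ∃ h : ℕ, H ≤ h ∧ ∀ L : ℕ, h ≤ L →
        (h : ℝ) ^ 2 * ∫ ω, ((minOpenCutIn
            (Set.Icc (![0, 0, 0] : Site 3) ![(L : ℤ), (L : ℤ), (h : ℤ)])
            (Set.Icc (![0, 0, 0] : Site 3) ![(L : ℤ), (L : ℤ), 0])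
            (Set.Icc (![0, 0, (h : ℤ)] : Site 3) ![(L : ℤ), (L : ℤ), (h : ℤ)])
            ω).toNat : ℝ) ∂(bondPercolation (zdGraph 3) (criticalProbI 3)) ≤ C * (L : ℝ) ^ 2 :=
  budgetTightness_iff_slabCutQuadraticIO

/-- **`BudgetTightness → MeanCutBoundedIO(p_c)`** (BK tail + Menger, `stub_bkTail`): from `(k, l, c)`,
along the good `n ≥ 1`, `E_{p_c}[MinCut(n, l n)] ≤ (k+1)/c`. -/
theorem meanCutBoundedIO_of_budgetTightness (hBT : BudgetTightness) :
    ∃ (l : ℕ) (C : ℝ), 2 ≤ l ∧ ∀ N : ℕ, ∃ n : ℕ, N ≤ n ∧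
      ∫ ω, ((minOpenCutIn (↑(box 3 (l * n)) : Set (Site 3)) (↑(box 3 n) : Set (Site 3))
        (↑(innerBoundary (zdGraph 3) (box 3 (l * n))) : Set (Site 3)) ω).toNat : ℝ)
        ∂(bondPercolation (zdGraph 3) (criticalProbI 3)) ≤ C := by
  obtain ⟨k, l, c, hl, hc, hio⟩ := hBT
  refine ⟨l, ((k : ℝ) + 1) / c, hl, fun N => ?_⟩
  obtain ⟨n, hn, hbound⟩ := hio (max N 1)
  have hn1 : 1 ≤ n := le_trans (le_max_right _ _) hn
  refine ⟨n, le_trans (le_max_left _ _) hn, ?_⟩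
  have hev : {ω : BondConfig (Site 3) | ∃ S : Finset (Sym2 (Site 3)), S.card ≤ k ∧
      ¬ ∃ x ∈ box 3 n, ∃ y ∈ innerBoundary (zdGraph 3) (box 3 (l * n)),
        (ω \ ↑S) ∈ openConnIn (↑(box 3 (l * n)) : Set (Site 3)) x y} =
      {ω | minOpenCutIn (↑(box 3 (l * n)) : Set (Site 3)) (↑(box 3 n) : Set (Site 3))
          (↑(innerBoundary (zdGraph 3) (box 3 (l * n))) : Set (Site 3)) ω ≤ k} := by
    ext ω
    simp only [Set.mem_setOf_eq, minOpenCutIn_le_iff, Finset.mem_coe]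
  rw [hev] at hbound
  exact stub_bkTail (criticalProbI 3) n l k c hn1 hl hc hbound

/-- **THE DICTIONARY, annulus form: `BudgetTightness ⟺ MeanCutBoundedIO(p_c)`** — tightness of the
critical annulus min-cut law along a subsequence is EQUIVALENT to boundedness of its first moment along a
subsequence: `∃ l C, 2 ≤ l ∧ ∀ N, ∃ n ≥ N, E_{p_c}[MinCut(n, l n)] ≤ C` (⇐ Markov, ⇒ BK + Menger). -/
theorem budgetTightness_iff_meanCutBoundedIO :
    BudgetTightness ↔
      ∃ (l : ℕ) (C : ℝ), 2 ≤ l ∧ ∀ N : ℕ, ∃ n : ℕ, N ≤ n ∧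
        ∫ ω, ((minOpenCutIn (↑(box 3 (l * n)) : Set (Site 3)) (↑(box 3 n) : Set (Site 3))
          (↑(innerBoundary (zdGraph 3) (box 3 (l * n))) : Set (Site 3)) ω).toNat : ℝ)
          ∂(bondPercolation (zdGraph 3) (criticalProbI 3)) ≤ C :=
  ⟨meanCutBoundedIO_of_budgetTightness, fun h => stub_markov h⟩

/-- Bottom and top layer of `Q(L,h)` are disjoint for `h ≥ 1`, so the slab budget is finite. -/
theorem slabBudget_ne_top {L h : ℕ} (hh : 1 ≤ h) (ω : BondConfig (Site 3)) :
    minOpenCutIn (Set.Icc (![0, 0, 0] : Site 3) ![(L : ℤ), (L : ℤ), (h : ℤ)])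
      (Set.Icc (![0, 0, 0] : Site 3) ![(L : ℤ), (L : ℤ), 0])
      (Set.Icc (![0, 0, (h : ℤ)] : Site 3) ![(L : ℤ), (L : ℤ), (h : ℤ)]) ω ≠ ⊤ := by
  rw [Ne, minOpenCutIn_eq_top_iff_of_finite (Set.finite_Icc _ _)]
  rintro ⟨a, -, ha, ha'⟩
  have h1 := (Set.mem_Icc.1 ha).2 2
  have h2 := (Set.mem_Icc.1 ha').1 2
  simp only [Matrix.cons_val] at h1 h2
  omega

/-- **The DENSITY half is necessary for the slab core** (`stub_numCrossingLe` in expectation): any bound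
`h²·E[S(L,h)] ≤ C·L²` along thicknesses `h` (w.l.o.g. `h ≥ 1`) gives the same bound for the expected number
`E[N(L,h)]` of open clusters of `Q(L,h)` meeting bottom and top. -/
theorem numCrossingQuadraticIO_of_slabCutQuadraticIO
    (hC : ∃ C : ℝ, ∀ H : ℕ, ∃ h : ℕ, H ≤ h ∧ ∀ L : ℕ, h ≤ L →
      (h : ℝ) ^ 2 * ∫ ω, ((minOpenCutIn
          (Set.Icc (![0, 0, 0] : Site 3) ![(L : ℤ), (L : ℤ), (h : ℤ)])
          (Set.Icc (![0, 0, 0] : Site 3) ![(L : ℤ), (L : ℤ), 0])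
          (Set.Icc (![0, 0, (h : ℤ)] : Site 3) ![(L : ℤ), (L : ℤ), (h : ℤ)])
          ω).toNat : ℝ) ∂(bondPercolation (zdGraph 3) (criticalProbI 3)) ≤ C * (L : ℝ) ^ 2) :
    ∃ C : ℝ, ∀ H : ℕ, ∃ h : ℕ, H ≤ h ∧ ∀ L : ℕ, h ≤ L →
      (h : ℝ) ^ 2 * ∫ ω, (({c : ((openGraph ω).induce
          (Set.Icc (![0, 0, 0] : Site 3) ![(L : ℤ), (L : ℤ), (h : ℤ)])).ConnectedComponent |
        (∃ x : ↥(Set.Icc (![0, 0, 0] : Site 3) ![(L : ℤ), (L : ℤ), (h : ℤ)]),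
          (x : Site 3) ∈ Set.Icc (![0, 0, 0] : Site 3) ![(L : ℤ), (L : ℤ), 0] ∧
          ((openGraph ω).induce (Set.Icc (![0, 0, 0] : Site 3) ![(L : ℤ), (L : ℤ), (h : ℤ)])).connectedComponentMk x = c) ∧
        ∃ y : ↥(Set.Icc (![0, 0, 0] : Site 3) ![(L : ℤ), (L : ℤ), (h : ℤ)]),
          (y : Site 3) ∈ Set.Icc (![0, 0, (h : ℤ)] : Site 3) ![(L : ℤ), (L : ℤ), (h : ℤ)] ∧
          ((openGraph ω).induce (Set.Icc (![0, 0, 0] : Site 3) ![(L : ℤ), (L : ℤ), (h : ℤ)])).connectedComponentMk y = c}.encard).toNat : ℝ)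
        ∂(bondPercolation (zdGraph 3) (criticalProbI 3)) ≤ C * (L : ℝ) ^ 2 := by
  obtain ⟨C, hcore⟩ := hC
  refine ⟨C, fun H => ?_⟩
  obtain ⟨h, hHh, hL⟩ := hcore (max H 1)
  have hh1 : 1 ≤ h := le_trans (le_max_right _ _) hHh
  refine ⟨h, le_trans (le_max_left _ _) hHh, fun L hLh => le_trans ?_ (hL L hLh)⟩
  refine mul_le_mul_of_nonneg_left ?_ (by positivity)
  exact CoreDensity.integral_numCrossing_le (Set.finite_Icc _ _) _ _ _
    (StubSixLids.integrable_toNat_minOpenCutIn (Set.finite_Icc _ _) _ _ _ _)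
    (slabBudget_ne_top hh1)

/-- **The crux implies tight crossing-cluster density in slabs** (`BudgetTightness ⇒ ∃ C, ∀ H, ∃ h ≥ H,
∀ L ≥ h, h²·E_{p_c}[N(L,h)] ≤ C·L²`): the `d < 6` hyperscaling statement "O((L/h)²) spanning clusters of the
slab piece" is a NECESSARY condition for rung r2 of `PercBudgetLadder` (dictionary + weak duality). Its
negation — a divergence `h²·E_{p_c}[N(h,h)]`-wise of the critical crossing-cluster density of `ℤ³`, the
`d > 6` picture of Aizenman 1997 — would refute the crux. -/
theorem numCrossingQuadraticIO_of_budgetTightness (hBT : BudgetTightness) :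
    ∃ C : ℝ, ∀ H : ℕ, ∃ h : ℕ, H ≤ h ∧ ∀ L : ℕ, h ≤ L →
      (h : ℝ) ^ 2 * ∫ ω, (({c : ((openGraph ω).induce
          (Set.Icc (![0, 0, 0] : Site 3) ![(L : ℤ), (L : ℤ), (h : ℤ)])).ConnectedComponent |
        (∃ x : ↥(Set.Icc (![0, 0, 0] : Site 3) ![(L : ℤ), (L : ℤ), (h : ℤ)]),
          (x : Site 3) ∈ Set.Icc (![0, 0, 0] : Site 3) ![(L : ℤ), (L : ℤ), 0] ∧
          ((openGraph ω).induce (Set.Icc (![0, 0, 0] : Site 3) ![(L : ℤ), (L : ℤ), (h : ℤ)])).connectedComponentMk x = c) ∧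
        ∃ y : ↥(Set.Icc (![0, 0, 0] : Site 3) ![(L : ℤ), (L : ℤ), (h : ℤ)]),
          (y : Site 3) ∈ Set.Icc (![0, 0, (h : ℤ)] : Site 3) ![(L : ℤ), (L : ℤ), (h : ℤ)] ∧
          ((openGraph ω).induce (Set.Icc (![0, 0, 0] : Site 3) ![(L : ℤ), (L : ℤ), (h : ℤ)])).connectedComponentMk y = c}.encard).toNat : ℝ)
        ∂(bondPercolation (zdGraph 3) (criticalProbI 3)) ≤ C * (L : ℝ) ^ 2 :=
  numCrossingQuadraticIO_of_slabCutQuadraticIO (slabCutQuadraticIO_of_budgetTightness hBT)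

end Summit.CriticalPhenomena.PercolationContinuityZ3.Theorems.BudgetTightness

end
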